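import Summits.CriticalPhenomena.PercolationContinuityZ3.Theses.PercTruncatedSusceptibility
import Summits.CriticalPhenomena.PercolationContinuityZ3.Theorems.PercNearOneGluingNoHeavyLowerTailCSHTheoremOne
import Summits.CriticalPhenomena.PercolationContinuityZ3.Theorems.PercNearOneGluingNoHeavyRsw3InvasionFirstOutlet
import Literature.Probability.Percolation.SusceptibilityGammaOne
import HarnessLib

/-!
# `PercTruncatedSusceptibility.CritTruncatedSusceptibilityInfinite` (stmt-CriticalPhenomena-0850) — SETTLED after continuity

Item `stmt-CriticalPhenomena-0850` of route `CriticalPhenomena/PercTruncatedSusceptibility` (crux): `χ^f(p_c) = Σ_x P_{p_c}(0 ↔ x, 0 ↮ ∞) = ∞`.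

By p205010 the event `{0 ↔ ∞}` is `P_{p_c}`-null, so the truncated two-point function equals `τ_{p_c}(0,x)`; and `Σ_x τ_{p_c}(0,x) = E_{p_c}|C(0)| = ∞` (`Rsw3.expClusterSize_criticalProbI_eq_top`, Aizenman–Newman's `χ ≥ 1/(2d(p_c − p))`).  A summable real family would make that `ℝ≥0∞` sum finite.

builds on p205010 (kernel theorem, internal audit signed; external expert review pending) — USED (`CSH.percolationContinuityZ3_holds`).  RSW3 lane, lead gen 28 (prover-prim-rsw3-lead-g28-0):
'after continuity — the ledger harvest'.
References: G. Kozma, N. Nitzan (2024), Thm. 6 / Conj. 3 [KozmaNitzan2024]; G. Grimmett, *Percolation* (1999), §8 [GrimmettPercolation1999].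
-/

noncomputable section

namespace Summit.CriticalPhenomena.PercolationContinuityZ3.Theorems

namespace PercTruncatedSusceptibilityCritTruncatedSusceptibilityInfinite

open MeasureTheory Literature.Probability.Percolation Literature.Probability.LatticeModels
open scoped ENNReal

/-- **`PercTruncatedSusceptibility.CritTruncatedSusceptibilityInfinite` (stmt-CriticalPhenomena-0850), settled.**  `{0 ↔ ∞}` is null (p205010) and `E_{p_c}|C(0)| = ∞` (`Rsw3.expClusterSize_criticalProbI_eq_top`).
[cite: KozmaNitzan2024, Thm. 6 with Conj. 3 (p. 15)] -/
theorem critTruncatedSusceptibilityInfinite_proof : Summit.CriticalPhenomena.PercolationContinuityZ3.Theses.PercTruncatedSusceptibility.CritTruncatedSusceptibilityInfinite := by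
  intro hsum
  have h0 : theta (zdGraph 3) (0 : Site 3) (criticalProbI 3) = 0 := CSH.percolationContinuityZ3_holds
  have hnull : bondPercolation (zdGraph 3) (criticalProbI 3) (percolatesAt (0 : Site 3)) = 0 := by
    unfold theta at h0
    exact (measureReal_eq_zero_iff (measure_ne_top _ _)).1 h0
  have hdiff : ∀ x : Site 3, (bondPercolation (zdGraph 3) (criticalProbI 3)).real (openConn 0 x \ percolatesAt 0) =
      (bondPercolation (zdGraph 3) (criticalProbI 3)).real (openConn 0 x) := fun x => by
    simp only [measureReal_def, measure_sdiff_null hnull]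
  simp only [hdiff] at hsum
  have htop := Rsw3.expClusterSize_criticalProbI_eq_top (d := 3) (by norm_num)
  rw [expClusterSize_eq_tsum] at htop
  have hfin : ∑' y, bondPercolation (zdGraph 3) (criticalProbI 3) (openConn (0 : Site 3) y) ≠ ⊤ := by
    have heq : (fun y => bondPercolation (zdGraph 3) (criticalProbI 3) (openConn (0 : Site 3) y)) =
        fun y => ENNReal.ofReal ((bondPercolation (zdGraph 3) (criticalProbI 3)).real (openConn (0 : Site 3) y)) := by
      funext y; rw [ofReal_measureReal (measure_ne_top _ _)]
    rw [heq, ← ENNReal.ofReal_tsum_of_nonneg (fun _ => measureReal_nonneg) hsum]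
    exact ENNReal.ofReal_ne_top
  exact hfin htop

end PercTruncatedSusceptibilityCritTruncatedSusceptibilityInfinite

end Summit.CriticalPhenomena.PercolationContinuityZ3.Theorems

end
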